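import Literature.Analysis.FunctionSpaces.HardyInequalityTail
import Literature.NumberTheory.LFunctions.BurnolZetaSystems
import HarnessLib

/-!
# The `t`-side of Burnol's factor `s/(s−1)`: the tail average `∫_t^∞ k(u) du/u` and its right Mellin transform

LINE 1 — LABEL: RH-FREE (folklore real analysis around Burnol 2004b §4). bears_on: B-C/B-P (COLUMN 6
DBR) as infrastructure only (the converse clause (ii) of `Burnol2004b_prop4_1R`, and through it
`prop4_3`, `lemma4_4`, `prop4_5`). WHAT THIS IS NOT: nothing here concerns `ζ` or RH; nothing here
bears on the truth of RH.

Topic `NumberTheory/LFunctions` (support file for `BurnolZetaSystemsHardy.lean`; theorems only, no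
definitions, no named facts). Burnol [Burnol2004b, §4, TeX l.638–643]: "the right Mellin transform is
an isometric identification of `ℂ·𝟙_{0<t<a} + L²(a,∞; dt)` with `(s/(s−1)) A^s ℍ²`." On the `t`-side
the factor `s/(s−1) = 1 + 1/(s−1)` is realised by the **tail average** `(Pk)(t) = ∫_t^∞ k(u) du/u` of
`k ∈ L²(a,∞)` (`a > 0`, `k = 0` off `(a,∞)`): `Pk` is the constant `∫ₐ^∞ k(u)du/u` on `(0,a]`, it is
square-integrable on `(a,∞)` (Hardy's inequality, `Literature/Analysis/FunctionSpaces/HardyInequalityTail.lean`),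
and on the strip `½ < Re s < 1` its right Mellin transform converges absolutely with
`(Pk)^(s) = k̂(s)/(1 − s)` (Fubini: `∫₀^∞ t^{−s} ∫_t^∞ k(u)du/u dt = ∫₀^∞ k(u)u^{−1} ∫₀^u t^{−s}dt du`),
so that `(k − Pk)^(s) = (s/(s−1))·k̂(s)`. Main statements:

* `TailFactor.tailIntegral_eq_of_le` — `(Pk)(t) = (Pk)(a)` for `t ≤ a`;
* `TailFactor.mellinConvergent_tailIntegral`, `TailFactor.rightMellin_tailIntegral` — absolute
  convergence and `(Pk)^(s) = k̂(s)/(1−s)` on `½ < Re s < 1`;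
* `TailFactor.rightMellin_sub_tailIntegral` — `(k − Pk)^(s) = (s/(s−1)) k̂(s)` there;
* `TailFactor.memLp_indicator_tailIntegral` — `𝟙_{(a,∞)} Pk ∈ L²` with `∫ₐ^∞‖Pk‖² ≤ 4∫‖k‖²`.

## References

* J.-F. Burnol, *On Fourier and zeta(s)*, Forum Math. 16 (2004) = arXiv:math/0203120v7, §4
  (TeX l.638–643, and the proof of Prop. 4.1, l.659–669). [key `Burnol2004b`]
* G. H. Hardy, J. E. Littlewood, G. Pólya, *Inequalities*, 2nd ed. (1952), Thm. 328. [key `HardyLittlewoodPolya1952`]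
-/

noncomputable section

open Complex MeasureTheory Set Filter
open scoped Real Topology

namespace Literature.NumberTheory.LFunctions

namespace TailFactor

variable {k : ℝ → ℂ} {a : ℝ}

/-- For `k` vanishing on `(−∞, a]` and `t ≤ a`: `∫_t^∞ k(u)du/u = ∫ₐ^∞ k(u)du/u` — the tail average is
constant on `(0, a]`. [cite: Burnol2004b, §4 (arXiv:math/0203120v7 p. 7, TeX l.638–643)] -/
theorem tailIntegral_eq_of_le (hk0 : ∀ u, u ≤ a → k u = 0) {t : ℝ} (ht : t ≤ a) :
    ∫ u in Ioi t, k u / u = ∫ u in Ioi a, k u / u := by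
  have hsub : Ioi a ⊆ Ioi t := Ioi_subset_Ioi ht
  rw [← integral_indicator measurableSet_Ioi, ← integral_indicator measurableSet_Ioi]
  refine integral_congr_ae (ae_of_all _ fun u ↦ ?_)
  by_cases hu : u ∈ Ioi a
  · rw [indicator_of_mem hu, indicator_of_mem (hsub hu)]
  · rw [indicator_of_notMem hu]
    by_cases hu' : u ∈ Ioi t
    · rw [indicator_of_mem hu', hk0 u (not_lt.1 hu), zero_div]
    · rw [indicator_of_notMem hu']

/-- For `k ∈ L²` vanishing on `(−∞,a]`, `a > 0`, and `σ > ½`: `u ↦ ‖k(u)‖ u^{−σ}` is integrable on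
`(0, ∞)` (Cauchy–Schwarz on `(a, ∞)`) — absolute convergence of `k̂(s)` for `Re s > ½`, Burnol's
"`L²(a,∞; dt) → A^s ℍ²`". [cite: Burnol2004b, §1 and §4 (arXiv:math/0203120v7 pp. 4, 7; TeX l.350–355, 633–638)] -/
theorem integrableOn_norm_mul_rpow_neg (ha : 0 < a) (hk : MemLp k 2 volume)
    (hk0 : ∀ u, u ≤ a → k u = 0) {σ : ℝ} (hσ : 1 / 2 < σ) :
    IntegrableOn (fun u : ℝ ↦ ‖k u‖ * u ^ (-σ)) (Ioi 0) := by
  have h1 : IntegrableOn (fun u : ℝ ↦ ‖k u‖ * u ^ (-σ)) (Ioi a) := by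
    have hmeas : AEStronglyMeasurable (fun u : ℝ ↦ u ^ (-σ)) (volume.restrict (Ioi a)) :=
      (measurable_id.pow_const (-σ)).aestronglyMeasurable
    have hg : MemLp (fun u : ℝ ↦ u ^ (-σ)) 2 (volume.restrict (Ioi a)) := by
      refine (memLp_two_iff_integrable_sq hmeas).2 ?_
      have hi : IntegrableOn (fun u : ℝ ↦ u ^ (-(2 * σ))) (Ioi a) :=
        integrableOn_Ioi_rpow_of_lt (by linarith) ha
      refine hi.congr_fun (fun u hu ↦ ?_) measurableSet_Ioi
      have hu0 : 0 ≤ u := ha.le.trans (le_of_lt hu)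
      rw [← Real.rpow_natCast, ← Real.rpow_mul hu0]
      push_cast
      ring_nf
    exact ((hk.restrict _).norm).integrable_mul hg
  have h2 : IntegrableOn (fun u : ℝ ↦ ‖k u‖ * u ^ (-σ)) (Ioc 0 a) := by
    refine integrableOn_zero.congr_fun_ae ?_
    filter_upwards [ae_restrict_mem (μ := (volume : Measure ℝ)) measurableSet_Ioc] with u hu
    rw [hk0 u hu.2, norm_zero, zero_mul]
  rw [← Ioc_union_Ioi_eq_Ioi ha.le]
  exact h2.union h1

/-- `∫₀ᵘ t^{−σ} dt = u^{1−σ}/(1−σ)` as a set integral over `(0,u)` (`σ < 1`, `u > 0`). [folklore] -/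
private theorem setIntegral_Ioo_rpow_neg {σ u : ℝ} (hσ : σ < 1) (hu : 0 < u) :
    IntegrableOn (fun t : ℝ ↦ t ^ (-σ)) (Ioo 0 u) ∧
      ∫ t in Ioo 0 u, t ^ (-σ) = u ^ (1 - σ) / (1 - σ) := by
  have hint : IntervalIntegrable (fun t : ℝ ↦ t ^ (-σ)) volume 0 u :=
    intervalIntegral.intervalIntegrable_rpow' (by linarith)
  refine ⟨((intervalIntegrable_iff_integrableOn_Ioc_of_le hu.le).1 hint).mono_set
    Ioo_subset_Ioc_self, ?_⟩
  rw [← integral_Ioc_eq_integral_Ioo, ← intervalIntegral.integral_of_le hu.le,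
    integral_rpow (Or.inl (by linarith)), Real.zero_rpow (by linarith), sub_zero,
    show -σ + 1 = 1 - σ by ring]

/-- `∫₀ᵘ t^{−s} dt = u^{1−s}/(1−s)` as a set integral over `(0,u)` of the principal power
(`Re s < 1`, `u > 0`), written with the Mellin exponent `(1 − s) − 1 = −s`. [folklore] -/
private theorem setIntegral_Ioo_cpow {s : ℂ} (hs : s.re < 1) {u : ℝ} (hu : 0 < u) :
    IntegrableOn (fun t : ℝ ↦ (t : ℂ) ^ (1 - s - 1)) (Ioo 0 u) ∧
      ∫ t in Ioo 0 u, (t : ℂ) ^ (1 - s - 1) = (u : ℂ) ^ (1 - s) / (1 - s) := by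
  have hre : -1 < (1 - s - 1 : ℂ).re := by
    rw [sub_re, sub_re, one_re]; linarith
  have hint : IntervalIntegrable (fun t : ℝ ↦ (t : ℂ) ^ (1 - s - 1)) volume 0 u :=
    intervalIntegral.intervalIntegrable_cpow' hre
  refine ⟨((intervalIntegrable_iff_integrableOn_Ioc_of_le hu.le).1 hint).mono_set
    Ioo_subset_Ioc_self, ?_⟩
  have h1s : (1 : ℂ) - s ≠ 0 := by
    intro h
    have := congrArg Complex.re h
    rw [sub_re, one_re, zero_re] at this
    linarith
  rw [← integral_Ioc_eq_integral_Ioo, ← intervalIntegral.integral_of_le hu.le,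
    integral_cpow (Or.inl hre), show (1 : ℂ) - s - 1 + 1 = 1 - s by ring, ofReal_zero,
    zero_cpow h1s, sub_zero]

/-- The Fubini integrand `F(t,u) = 1_{t<u} t^{−s} k(u)/u` on `(0,∞)²` is integrable when
`½ < Re s < 1`, `k ∈ L²` vanishes on `(−∞, a]`, `a > 0`. [folklore] -/
private theorem integrable_kernel (ha : 0 < a) (hkm : Measurable k) (hk : MemLp k 2 volume)
    (hk0 : ∀ u, u ≤ a → k u = 0) {s : ℂ} (hs : 1 / 2 < s.re) (hs1 : s.re < 1) :
    Integrable (Function.uncurry fun (t u : ℝ) ↦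
        if t < u then (t : ℂ) ^ (1 - s - 1) * (k u / u) else 0)
      ((volume.restrict (Ioi (0 : ℝ))).prod (volume.restrict (Ioi (0 : ℝ)))) := by
  set F : ℝ → ℝ → ℂ := fun t u ↦ if t < u then (t : ℂ) ^ (1 - s - 1) * (k u / u) else 0 with hF
  have hFm : Measurable (Function.uncurry F) := by
    refine Measurable.ite (measurableSet_lt measurable_fst measurable_snd) ?_ measurable_const
    exact ((Complex.measurable_ofReal.comp measurable_fst).pow_const _).mul
      ((hkm.comp measurable_snd).div (Complex.measurable_ofReal.comp measurable_snd))
  rw [integrable_prod_iff' hFm.aestronglyMeasurable]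
  have hre : (1 - s - 1 : ℂ).re = -s.re := by rw [sub_re, sub_re, one_re]; ring
  -- norm of the kernel
  have hnormF : ∀ t u : ℝ, 0 < t → ‖F t u‖ = (if t < u then t ^ (-s.re) * (‖k u‖ / u) else 0) := by
    intro t u ht
    simp only [hF]
    by_cases htu : t < u
    · rw [if_pos htu, if_pos htu, norm_mul, norm_cpow_eq_rpow_re_of_pos ht, hre, norm_div,
        Complex.norm_real, Real.norm_eq_abs, abs_of_pos (ht.trans htu)]
    · rw [if_neg htu, if_neg htu, norm_zero]
  refine ⟨?_, ?_⟩
  · -- slices `t ↦ F t u` are integrable on `(0,∞)` for every `u > 0`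
    filter_upwards [ae_restrict_mem (μ := (volume : Measure ℝ)) measurableSet_Ioi] with u hu
    have hslice : (fun t : ℝ ↦ F t u) =
        fun t ↦ (Iio u).indicator (fun t : ℝ ↦ (t : ℂ) ^ (1 - s - 1) * (k u / u)) t := by
      funext t; simp only [hF, indicator, mem_Iio]
    show Integrable (fun t : ℝ ↦ F t u) (volume.restrict (Ioi 0))
    rw [hslice, integrable_indicator_iff measurableSet_Iio, IntegrableOn,
      Measure.restrict_restrict measurableSet_Iio,
      show Iio u ∩ Ioi (0 : ℝ) = Ioo 0 u from by ext t; simp [and_comm]]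
    exact ((setIntegral_Ioo_cpow hs1 hu).1).mul_const _
  · -- `u ↦ ∫₀^∞ ‖F t u‖ dt = ‖k u‖ u^{−Re s}/(1 − Re s)` is integrable on `(0,∞)`
    have hc : (1 - s.re) ≠ 0 := ne_of_gt (by linarith)
    have hval : ∀ u : ℝ, 0 < u →
        ∫ t in Ioi (0 : ℝ), ‖F t u‖ = ‖k u‖ * u ^ (-s.re) / (1 - s.re) := by
      intro u hu
      have hu1 : u ^ (1 - s.re) = u * u ^ (-s.re) := by
        rw [show (1 - s.re) = 1 + (-s.re) by ring, Real.rpow_add hu, Real.rpow_one]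
      calc ∫ t in Ioi (0 : ℝ), ‖F t u‖
          = ∫ t in Ioi (0 : ℝ), (Iio u).indicator (fun t : ℝ ↦ t ^ (-s.re) * (‖k u‖ / u)) t := by
            refine setIntegral_congr_fun measurableSet_Ioi fun t ht ↦ ?_
            rw [hnormF t u ht]
            simp only [indicator, mem_Iio]
        _ = ∫ t in Ioo (0 : ℝ) u, t ^ (-s.re) * (‖k u‖ / u) := by
            rw [setIntegral_indicator measurableSet_Iio, Ioi_inter_Iio]
        _ = (∫ t in Ioo (0 : ℝ) u, t ^ (-s.re)) * (‖k u‖ / u) := integral_mul_const _ _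
        _ = u ^ (1 - s.re) / (1 - s.re) * (‖k u‖ / u) := by rw [(setIntegral_Ioo_rpow_neg hs1 hu).2]
        _ = ‖k u‖ * u ^ (-s.re) / (1 - s.re) := by
            rw [hu1]
            field_simp
    have hI : IntegrableOn (fun u : ℝ ↦ ‖k u‖ * u ^ (-s.re) / (1 - s.re)) (Ioi 0) :=
      (integrableOn_norm_mul_rpow_neg ha hk hk0 hs).div_const (1 - s.re)
    show Integrable (fun u : ℝ ↦ ∫ t in Ioi (0 : ℝ), ‖F t u‖) (volume.restrict (Ioi 0))
    exact IntegrableOn.congr_fun hI (fun u hu ↦ (hval u hu).symm) measurableSet_Ioi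

/-- Inner integral in `u`: for `t > 0`, `∫₀^∞ F(t,u) du = t^{−s} ∫_t^∞ k(u) du/u`. [folklore] -/
private theorem integral_kernel_right (s : ℂ) {t : ℝ} (ht : 0 < t) :
    ∫ u in Ioi (0 : ℝ), (if t < u then (t : ℂ) ^ (1 - s - 1) * (k u / u) else 0) =
      (t : ℂ) ^ (1 - s - 1) * ∫ u in Ioi t, k u / u := by
  have h1 : (fun u : ℝ ↦ (if t < u then (t : ℂ) ^ (1 - s - 1) * (k u / u) else 0)) =
      fun u ↦ (Ioi t).indicator (fun u : ℝ ↦ (t : ℂ) ^ (1 - s - 1) * (k u / u)) u := by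
    funext u; simp only [indicator, mem_Ioi]
  rw [h1, setIntegral_indicator measurableSet_Ioi, Ioi_inter_Ioi, max_eq_right ht.le,
    integral_const_mul]

/-- Inner integral in `t`: for `u > 0` and `Re s < 1`, `∫₀^∞ F(t,u) dt = u^{−s} k(u)/(1 − s)`. [folklore] -/
private theorem integral_kernel_left {s : ℂ} (hs1 : s.re < 1) {u : ℝ} (hu : 0 < u) :
    ∫ t in Ioi (0 : ℝ), (if t < u then (t : ℂ) ^ (1 - s - 1) * (k u / u) else 0) =
      (u : ℂ) ^ (1 - s - 1) * k u / (1 - s) := by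
  have hu0 : (u : ℂ) ≠ 0 := ofReal_ne_zero.2 hu.ne'
  have h1 : (fun t : ℝ ↦ (if t < u then (t : ℂ) ^ (1 - s - 1) * (k u / u) else 0)) =
      fun t ↦ (Iio u).indicator (fun t : ℝ ↦ (t : ℂ) ^ (1 - s - 1) * (k u / u)) t := by
    funext t; simp only [indicator, mem_Iio]
  rw [h1, setIntegral_indicator measurableSet_Iio, Ioi_inter_Iio, integral_mul_const,
    (setIntegral_Ioo_cpow hs1 hu).2]
  have e : (u : ℂ) ^ (1 - s - 1) = (u : ℂ) ^ (1 - s) / u := by rw [cpow_sub _ _ hu0, cpow_one]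
  rw [e]
  ring

/-- RH-FREE. For `a > 0`, `k ∈ L²(ℝ)` measurable and vanishing on `(−∞, a]`, and `½ < Re s`: the
right Mellin transform of `k` converges absolutely at `s`. [cite: Burnol2004b, §4 (arXiv:math/0203120v7 p. 7, TeX l.633–638)] -/
theorem mellinConvergent_of_memLp (ha : 0 < a) (hk : MemLp k 2 volume)
    (hk0 : ∀ u, u ≤ a → k u = 0) {s : ℂ} (hs : 1 / 2 < s.re) : MellinConvergent k (1 - s) := by
  refine Integrable.mono' (integrableOn_norm_mul_rpow_neg ha hk hk0 hs) ?_ ?_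
  · exact ((Complex.measurable_ofReal.pow_const _).aestronglyMeasurable).smul hk.1.restrict
  · filter_upwards [ae_restrict_mem (μ := (volume : Measure ℝ)) measurableSet_Ioi] with t ht
    have hre : (1 - s - 1 : ℂ).re = -s.re := by rw [sub_re, sub_re, one_re]; ring
    rw [norm_smul, norm_cpow_eq_rpow_re_of_pos ht, hre, mul_comm]

/-- RH-FREE. **Absolute convergence of `(Pk)^(s)` on the strip**: for `a > 0`, `k ∈ L²(ℝ)` measurable
and vanishing on `(−∞, a]`, and `½ < Re s < 1`, the right Mellin transform of the tail average
`t ↦ ∫_t^∞ k(u) du/u` converges absolutely at `s`.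
[cite: Burnol2004b, §4 (arXiv:math/0203120v7 p. 7, TeX l.638–643)] -/
theorem mellinConvergent_tailIntegral (ha : 0 < a) (hkm : Measurable k) (hk : MemLp k 2 volume)
    (hk0 : ∀ u, u ≤ a → k u = 0) {s : ℂ} (hs : 1 / 2 < s.re) (hs1 : s.re < 1) :
    MellinConvergent (fun t : ℝ ↦ ∫ u in Ioi t, k u / u) (1 - s) := by
  have hI := (integrable_kernel ha hkm hk hk0 hs hs1).integral_prod_left
  refine hI.congr ?_
  filter_upwards [ae_restrict_mem (μ := (volume : Measure ℝ)) measurableSet_Ioi] with t ht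
  show (∫ u in Ioi (0 : ℝ), (if t < u then (t : ℂ) ^ (1 - s - 1) * (k u / u) else 0)) =
    (t : ℂ) ^ (1 - s - 1) • ∫ u in Ioi t, k u / u
  rw [integral_kernel_right s ht, smul_eq_mul]

/-- RH-FREE. **`(Pk)^(s) = k̂(s)/(1 − s)` on the strip `½ < Re s < 1`** for the tail average
`(Pk)(t) = ∫_t^∞ k(u) du/u` of a measurable `k ∈ L²(ℝ)` vanishing on `(−∞, a]`, `a > 0` (Fubini:
`∫₀^∞ t^{−s}∫_t^∞ k(u)du/u dt = ∫₀^∞ k(u)u^{−1}∫₀^u t^{−s}dt du = (1−s)^{−1}∫₀^∞ k(u)u^{−s}du`). This is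
the `t`-side of the factor `1/(s−1)` in Burnol's `(s/(s−1))A^sℍ²`.
[cite: Burnol2004b, §4 (arXiv:math/0203120v7 p. 7, TeX l.638–643)] -/
theorem rightMellin_tailIntegral (ha : 0 < a) (hkm : Measurable k) (hk : MemLp k 2 volume)
    (hk0 : ∀ u, u ≤ a → k u = 0) {s : ℂ} (hs : 1 / 2 < s.re) (hs1 : s.re < 1) :
    rightMellin (fun t : ℝ ↦ ∫ u in Ioi t, k u / u) s = rightMellin k s / (1 - s) := by
  have hker := integrable_kernel ha hkm hk hk0 hs hs1
  have hswap := integral_integral_swap hker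
  show (∫ t in Ioi (0 : ℝ), (t : ℂ) ^ (1 - s - 1) • ∫ u in Ioi t, k u / u) =
    (∫ u in Ioi (0 : ℝ), (u : ℂ) ^ (1 - s - 1) • k u) / (1 - s)
  calc (∫ t in Ioi (0 : ℝ), (t : ℂ) ^ (1 - s - 1) • ∫ u in Ioi t, k u / u)
      = ∫ t in Ioi (0 : ℝ), ∫ u in Ioi (0 : ℝ),
          (if t < u then (t : ℂ) ^ (1 - s - 1) * (k u / u) else 0) := by
        refine setIntegral_congr_fun measurableSet_Ioi fun t ht ↦ ?_
        rw [integral_kernel_right s ht, smul_eq_mul]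
    _ = ∫ u in Ioi (0 : ℝ), ∫ t in Ioi (0 : ℝ),
          (if t < u then (t : ℂ) ^ (1 - s - 1) * (k u / u) else 0) := hswap
    _ = ∫ u in Ioi (0 : ℝ), (u : ℂ) ^ (1 - s - 1) • k u / (1 - s) := by
        refine setIntegral_congr_fun measurableSet_Ioi fun u hu ↦ ?_
        rw [integral_kernel_left hs1 hu, smul_eq_mul]
    _ = (∫ u in Ioi (0 : ℝ), (u : ℂ) ^ (1 - s - 1) • k u) / (1 - s) := integral_div _ _

/-- RH-FREE. **The `t`-side of Burnol's factor `s/(s−1)`**: for `a > 0`, `k ∈ L²(ℝ)` measurable and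
vanishing on `(−∞, a]`, and `½ < Re s < 1`, the function `f = k − Pk` (which equals the CONSTANT
`−∫ₐ^∞ k(u)du/u` on `(0, a]`, `TailFactor.tailIntegral_eq_of_le`) has absolutely convergent right
Mellin transform `f̂(s) = (s/(s−1))·k̂(s)` — "the right Mellin transform is an isometric identification
of `ℂ·𝟙_{0<t<a} + L²(a,∞;dt)` with `(s/(s−1))A^sℍ²`", the direction `A^sℍ² → (ℂ·𝟙 + L²)`-side.
[cite: Burnol2004b, §4 (arXiv:math/0203120v7 p. 7, TeX l.638–643)] -/
theorem rightMellin_sub_tailIntegral (ha : 0 < a) (hkm : Measurable k) (hk : MemLp k 2 volume)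
    (hk0 : ∀ u, u ≤ a → k u = 0) {s : ℂ} (hs : 1 / 2 < s.re) (hs1 : s.re < 1) :
    MellinConvergent (fun t : ℝ ↦ k t - ∫ u in Ioi t, k u / u) (1 - s) ∧
      rightMellin (fun t : ℝ ↦ k t - ∫ u in Ioi t, k u / u) s = s / (s - 1) * rightMellin k s := by
  have hk1 := mellinConvergent_of_memLp ha hk hk0 hs
  have hP := mellinConvergent_tailIntegral ha hkm hk hk0 hs hs1
  have h1s : (1 : ℂ) - s ≠ 0 := by
    intro h
    have := congrArg Complex.re h
    rw [sub_re, one_re, zero_re] at this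
    linarith
  have hs1' : s - 1 ≠ 0 := by
    intro h; apply h1s; rw [sub_eq_zero] at h; rw [h, sub_self]
  refine ⟨?_, ?_⟩
  · have h := hk1.sub hP
    refine h.congr (ae_of_all _ fun t ↦ ?_)
    simp only [Pi.sub_apply, smul_sub]
  · have hPval := rightMellin_tailIntegral ha hkm hk hk0 hs hs1
    change mellin (fun t : ℝ ↦ ∫ u in Ioi t, k u / u) (1 - s) = mellin k (1 - s) / (1 - s) at hPval
    show (∫ t in Ioi (0 : ℝ), (t : ℂ) ^ (1 - s - 1) • (k t - ∫ u in Ioi t, k u / u)) =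
      s / (s - 1) * mellin k (1 - s)
    simp_rw [smul_sub]
    rw [integral_sub hk1 hP]
    change mellin k (1 - s) - mellin (fun t : ℝ ↦ ∫ u in Ioi t, k u / u) (1 - s) = _
    rw [hPval]
    field_simp
    ring

/-- RH-FREE. **`Pk ∈ L²(a, ∞)`** (Hardy's inequality): for `a > 0` and a measurable `k ∈ L²(ℝ)`, the
tail average restricted to `(a,∞)`, `𝟙_{(a,∞)}·Pk`, is in `L²(ℝ)` with `∫ₐ^∞ ‖Pk‖² ≤ 4 ∫ₐ^∞ ‖k‖²`.
[cite: HardyLittlewoodPolya1952, Thm. 328; Burnol2004b, §4 (arXiv:math/0203120v7 p. 7, TeX l.638–643)] -/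
theorem memLp_indicator_tailIntegral (ha : 0 < a) (hkm : Measurable k) (hk : MemLp k 2 volume) :
    MemLp (fun t : ℝ ↦ (Ioi a).indicator (fun t : ℝ ↦ ∫ u in Ioi t, k u / u) t) 2 volume ∧
      ∫ t in Ioi a, ‖∫ u in Ioi t, k u / u‖ ^ 2 ≤ 4 * ∫ u in Ioi a, ‖k u‖ ^ 2 := by
  obtain ⟨-, hPi, hP⟩ :=
    Literature.Analysis.FunctionSpaces.hardy_tail_norm_sq_integral_le ha hkm (hk.restrict _)
  refine ⟨?_, hP⟩
  have hPm : StronglyMeasurable (fun t : ℝ ↦ ∫ u in Ioi t, k u / u) := by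
    have hG : StronglyMeasurable
        (Function.uncurry fun (t u : ℝ) ↦ if t < u then k u / u else 0) := by
      refine Measurable.stronglyMeasurable ?_
      refine Measurable.ite (measurableSet_lt measurable_fst measurable_snd) ?_ measurable_const
      exact (hkm.comp measurable_snd).div (Complex.measurable_ofReal.comp measurable_snd)
    have h := hG.integral_prod_right (ν := (volume : Measure ℝ))
    have hfun : (fun t : ℝ ↦ ∫ u in Ioi t, k u / u) =
        fun t ↦ ∫ u, (fun (t u : ℝ) ↦ if t < u then k u / u else 0) t u := by
      funext t
      rw [← integral_indicator measurableSet_Ioi]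
      congr 1
    rw [hfun]
    exact h
  refine (memLp_two_iff_integrable_sq_norm
    ((hPm.measurable.indicator measurableSet_Ioi).aestronglyMeasurable)).2 ?_
  have hind : (fun t : ℝ ↦ ‖(Ioi a).indicator (fun t : ℝ ↦ ∫ u in Ioi t, k u / u) t‖ ^ 2) =
      (Ioi a).indicator (fun t : ℝ ↦ ‖∫ u in Ioi t, k u / u‖ ^ 2) := by
    funext t
    by_cases ht : t ∈ Ioi a
    · rw [indicator_of_mem ht, indicator_of_mem ht]
    · rw [indicator_of_notMem ht, indicator_of_notMem ht, norm_zero, zero_pow two_ne_zero]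
  rw [hind, integrable_indicator_iff measurableSet_Ioi]
  exact hPi

end TailFactor

end Literature.NumberTheory.LFunctions
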